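import Summits.AtomisticToContinuum.HydrodynamicLimit.Theorems.JParityClosureLocalSecondLawCoarseFieldBounds
import Summits.AtomisticToContinuum.HydrodynamicLimit.Theorems.JParityClosureLocalSecondLawKineticStressAlgebra
import Literature.Analysis.FunctionSpaces.TorusSpaceTime
import Literature.Analysis.FunctionSpaces.TorusTestFunction

/-!
# Bounds for the heat-current pairing `T₃` of the entropy-ledger line: the cubic coarse heat current, the
# coarse temperature gradient, and the quotient rule for the crux's `pD`
(stmt-AtomisticToContinuum-13081, line `exact-entropy-ledger-three-passivities`; support of the stub
`stub_passivityThermal` (P3); file 1 of 3 of the thermal package, continued in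
`…ThermalHeatFluxRegularity.lean` (honesty of `T₃kin`, deterministic core) and `…PassivityThermalOfClosure.lean`
(the conditional form of P3))

`T₃kin = ∫₀^τ∫ ∑ₖ ∂ₖ(φ/θ_r) q^kin_{r,k}` pairs the weight `∇(φ/θ_r) = ∇φ/θ_r − φ∇θ_r/θ_r²` with the CUBIC peculiar
moment `q^kin_r = (N+1)⁻¹∑ᵢ b_r(xᵢ,·)|vᵢ−u_r|²/2 (vᵢ−u_r)` of the ledger vocabulary
(`Theorems/JParityClosureLocalSecondLawLedgerDefs.lean`).  This file proves the deterministic, configuration-level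
facts the junk audit and the deterministic core of P3 need:
* **quotient rule OR junk for `pD`** (`abs_pD_div_le`): for `f` differentiable along the `k`-th coordinate line at
  `x` and `g` continuous with `g x > 0`, `|∂ₖ(f/g)(x)| ≤ |∂ₖf(x)|/g(x) + |f(x)|·|∂ₖg(x)|/g(x)²` holds at EVERY point with
  Mathlib's junk-`0` derivatives: where `g` is line-differentiable it is the quotient rule; where it is not, `∂ₖg = 0`
  is junk but then either `f x = 0` (and `f/g` is honestly differentiable with derivative `∂ₖf/g`, by slopes) or `f/g`
  is not differentiable either (else `g = f/(f/g)` would be) and its `pD` is the junk `0`.  This is what lets the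
  thermal-strain antecedent of P3 be stated with the crux's own pointwise `pD k θ_r`;
* the coarse temperature `θ_r = (2/3)(e_r/ρ_r − ‖u_r‖²/2)` is continuous and LIPSCHITZ in the field point on the
  density floor `c ≤ ρ_r` with an explicit constant `L_θ(r, c, ke)` (`e_r` is `(3/πr⁴)ke`-Lipschitz, quotient and
  square estimates over `abs_rhoC_sub_le`, `norm_uC_sub_le`), hence `|∂ₖθ_r| ≤ L_θ` everywhere
  (`abs_pD_thetaC_le_of_floor`, via `abs_pD_le_of_lipschitz`); its FLOORED version
  `max((2/3)(e_r/max(ρ_r,c) − ‖m_r‖²/(2max(ρ_r,c)²)), c)` is jointly continuous in (configuration, field point) and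
  coincides with `θ_r` on the floors (the honest object behind the measurability of `T₃kin`'s integrand in time);
* `q^kin_r` as a particle sum, jointly Borel in (configuration, field point), and bounded on the density floor by
  `Q(N, r, c, ke) = (3/πr³)V³/2`, `V = ½ + (N+1)ke + (3/πr³)(½+ke)/c` a bound of every peculiar speed — crude and
  `N`-dependent, but along ONE orbit (energy conserved) it is all the honesty of `T₃kin` needs;
* the weight: a smooth space–time test function is jointly continuous, its slices are line-differentiable, and
  `|φ|`, `|∂ₖφ|` are bounded on `[0,τ] × 𝕋³` (`Torus.IsSmoothSpaceTimeOn.partialDeriv` + compactness).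
All names carry the prefix `psvT_` (passivity-thermal support) except the registered sub-goals at the end.

References: R. J. Hardy, J. Chem. Phys. 76 (1982) 622 (microscopic heat current with bond functions);
L. C. Evans, R. F. Gariepy, *Measure Theory and Fine Properties of Functions* (1992), §3.1 (only `|f′| ≤ Lip f`);
H. Spohn, *Large Scale Dynamics of Interacting Particles* (1991), Part I §3 (setting).
-/

noncomputable section

namespace Summit.AtomisticToContinuum.HydrodynamicLimit.Theorems.LocalSecondLawLedger

open scoped BigOperators Topology Classical MeasureTheory ENNReal InnerProductSpace
open Filter Set MeasureTheory
open Literature.MathematicalPhysics.KineticTheory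
open Literature.Analysis.FluidPDE
open Summit.AtomisticToContinuum.HydrodynamicLimit.Theorems.LocalSecondLawNegative

variable {N : ℕ}

/-! ## The quotient rule, or junk, for derivatives along coordinate lines -/


/-- Quotient rule OR junk: for `F` differentiable at `0`, `G` continuous at `0` with `G 0 > 0`,
`|(F/G)′(0)| ≤ |F′(0)|/G(0) + |F(0)|·|G′(0)|/G(0)²`, with Mathlib's junk-`0` derivatives everywhere. -/
theorem psvT_abs_deriv_div_le {F G : ℝ → ℝ} (hF : DifferentiableAt ℝ F 0) (hG : ContinuousAt G 0)
    (hG0 : 0 < G 0) :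
    |deriv (fun t => F t / G t) 0| ≤ |deriv F 0| / G 0 + |F 0| * |deriv G 0| / G 0 ^ 2 := by
  have h2 : 0 ≤ |F 0| * |deriv G 0| / G 0 ^ 2 := by positivity
  by_cases hF0 : F 0 = 0
  · -- `F(0) = 0`: the quotient IS differentiable at `0`, with derivative `F′(0)/G(0)`
    have hslope : Tendsto (slope (fun t => F t / G t) 0) (𝓝[≠] 0) (𝓝 (deriv F 0 / G 0)) := by
      have hFs : Tendsto (slope F 0) (𝓝[≠] 0) (𝓝 (deriv F 0)) :=
        hasDerivAt_iff_tendsto_slope.1 hF.hasDerivAt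
      have hGs : Tendsto G (𝓝[≠] 0) (𝓝 (G 0)) := hG.tendsto.mono_left nhdsWithin_le_nhds
      refine (hFs.div hGs hG0.ne').congr' (eventually_nhdsWithin_of_forall fun t _ => ?_)
      simp only [slope, vsub_eq_sub, sub_zero, hF0, zero_div, smul_eq_mul, Pi.div_apply]
      ring
    have hD : HasDerivAt (fun t => F t / G t) (deriv F 0 / G 0) 0 := hasDerivAt_iff_tendsto_slope.2 hslope
    rw [hD.deriv, abs_div, abs_of_pos hG0]
    linarith
  · by_cases hGd : DifferentiableAt ℝ G 0
    · rw [show (fun t => F t / G t) = F / G from rfl, deriv_div hF hGd hG0.ne', abs_div,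
        abs_of_pos (pow_pos hG0 2)]
      have hG2 : 0 < G 0 ^ 2 := pow_pos hG0 2
      rw [div_add_div _ _ hG0.ne' hG2.ne', div_le_div_iff₀ hG2 (mul_pos hG0 hG2)]
      have h1 : |deriv F 0 * G 0 - F 0 * deriv G 0| ≤ |deriv F 0| * G 0 + |F 0| * |deriv G 0| := by
        refine (abs_sub _ _).trans ?_
        rw [abs_mul, abs_mul, abs_of_pos hG0]
      calc |deriv F 0 * G 0 - F 0 * deriv G 0| * (G 0 * G 0 ^ 2)
          ≤ (|deriv F 0| * G 0 + |F 0| * |deriv G 0|) * (G 0 * G 0 ^ 2) :=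
            mul_le_mul_of_nonneg_right h1 (by positivity)
        _ = (|deriv F 0| * G 0 ^ 2 + G 0 * (|F 0| * |deriv G 0|)) * G 0 ^ 2 := by ring
    · -- `F(0) ≠ 0`, `G` not differentiable: neither is `F/G` (else `G = F/(F/G)` would be)
      have hnd : ¬DifferentiableAt ℝ (fun t => F t / G t) 0 := by
        intro hH
        apply hGd
        have hH0 : F 0 / G 0 ≠ 0 := div_ne_zero hF0 hG0.ne'
        have hFne : ∀ᶠ t in 𝓝 (0 : ℝ), F t ≠ 0 := hF.continuousAt.eventually_ne hF0
        have hGne : ∀ᶠ t in 𝓝 (0 : ℝ), G t ≠ 0 := hG.eventually_ne hG0.ne'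
        have heq : (fun t => F t / (F t / G t)) =ᶠ[𝓝 0] G := by
          filter_upwards [hFne, hGne] with t hFt hGt
          field_simp
        exact ((hF.div hH hH0).congr_of_eventuallyEq heq.symm)
      rw [deriv_zero_of_not_differentiableAt hnd, deriv_zero_of_not_differentiableAt hGd]
      simp only [abs_zero, mul_zero, zero_div, add_zero]
      positivity

/-- **Quotient rule or junk for the crux's `pD`.**  For `f` differentiable at `x` along the `k`-th coordinate line,
`g` continuous with `g x > 0`: `|∂ₖ(f/g)(x)| ≤ |∂ₖf(x)|/g(x) + |f(x)|·|∂ₖg(x)|/g(x)²` — where `g` is line-differentiable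
this is the quotient rule; where it is not, `∂ₖg(x) = 0` is junk but then either `f x = 0` (and `∂ₖ(f/g) = ∂ₖf/g`
honestly) or `f/g` is not line-differentiable either (its `pD` is the junk `0`). -/
theorem psvT_abs_pD_div_le {f g : T3 → ℝ} {k : Fin 3} {x : T3}
    (hf : DifferentiableAt ℝ (fun t : ℝ => f (x + tproj (t • EuclideanSpace.single k (1 : ℝ)))) 0)
    (hg : Continuous g) (hgx : 0 < g x) :
    |pD k (fun y => f y / g y) x| ≤ |pD k f x| / g x + |f x| * |pD k g x| / g x ^ 2 := by
  have h0 : x + tproj ((0 : ℝ) • EuclideanSpace.single k (1 : ℝ)) = x := by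
    rw [zero_smul]; exact add_zero x
  have hG : ContinuousAt (fun t : ℝ => g (x + tproj (t • EuclideanSpace.single k (1 : ℝ)))) 0 :=
    (hg.comp (continuous_const.add (Literature.Analysis.FunctionSpaces.Torus.continuous_proj.comp
      (continuous_id.smul continuous_const)))).continuousAt
  have h := psvT_abs_deriv_div_le hf hG (by rw [h0]; exact hgx)
  rw [h0] at h
  exact h

/-! ## The weight: a smooth space–time test function and its gradient -/

/-- A smooth space–time test function is jointly continuous on `ℝ × 𝕋³`. -/
theorem psvT_continuous_uncurry {φ : ℝ → T3 → ℝ}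
    (hφ : Literature.Analysis.FunctionSpaces.Torus.IsSmoothSpaceTimeOn Set.univ φ) :
    Continuous (Function.uncurry φ) := by
  refine Literature.Analysis.FunctionSpaces.Torus.continuous_uncurry_of_continuous_stLift ?_
  have h := hφ.continuousOn_stLift
  rw [Set.univ_prod_univ] at h
  exact continuousOn_univ.1 h

/-- The slices of a smooth space–time test function are differentiable along coordinate lines. -/
theorem psvT_differentiableAt_line {φ : ℝ → T3 → ℝ}
    (hφ : Literature.Analysis.FunctionSpaces.Torus.IsSmoothSpaceTimeOn Set.univ φ) (s : ℝ) (x : T3) (e : V3) :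
    DifferentiableAt ℝ (fun t : ℝ => φ s (x + tproj (t • e))) 0 := by
  have hs : Literature.Analysis.FunctionSpaces.Torus.IsSmooth (φ s) := hφ.isSmooth_slice (Set.mem_univ s)
  have h1 := hs.liftAt x
  have h2 : Differentiable ℝ (fun t : ℝ => Literature.Analysis.FunctionSpaces.Torus.liftAt (φ s) x (t • e)) :=
    (h1.differentiable (by simp)).comp (differentiable_id.smul_const e)
  exact (h2 0)

/-- Uniform bounds of a smooth space–time test function and of its space gradient on `[0, τ] × 𝕋³`. -/
theorem psvT_phi_bounds {φ : ℝ → T3 → ℝ}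
    (hφ : Literature.Analysis.FunctionSpaces.Torus.IsSmoothSpaceTimeOn Set.univ φ) (τ : ℝ) :
    ∃ M M' : ℝ, 0 ≤ M ∧ 0 ≤ M' ∧ (∀ s ∈ Set.Icc (0 : ℝ) τ, ∀ x, |φ s x| ≤ M) ∧
      ∀ s ∈ Set.Icc (0 : ℝ) τ, ∀ x, ∀ k : Fin 3, |pD k (φ s) x| ≤ M' := by
  obtain ⟨M₀, hM₀⟩ := hφ.exists_norm_le_of_isCompact isCompact_Icc (Set.subset_univ (Set.Icc (0 : ℝ) τ))
  have hD := fun k : Fin 3 => (hφ.partialDeriv uniqueDiffOn_univ k).exists_norm_le_of_isCompact isCompact_Icc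
    (Set.subset_univ (Set.Icc (0 : ℝ) τ))
  choose C hC using hD
  refine ⟨max M₀ 0, ∑ k, |C k|, le_max_right _ _, Finset.sum_nonneg fun k _ => abs_nonneg _,
    fun s hs x => ?_, fun s hs x k => ?_⟩
  · rw [← Real.norm_eq_abs]; exact (hM₀ s hs x).trans (le_max_left _ _)
  · have h1 : |pD k (φ s) x| ≤ C k := by rw [← Real.norm_eq_abs]; exact hC k s hs x
    calc |pD k (φ s) x| ≤ |C k| := h1.trans (le_abs_self _)
      _ ≤ ∑ k', |C k'| := Finset.single_le_sum (f := fun k' => |C k'|) (fun k' _ => abs_nonneg _)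
          (Finset.mem_univ k)

/-! ## The cubic coarse heat current `q^kin_r`: particle sum, measurability, bound on the density floor -/

/-- Empirical average of a vector-valued observable: `∫ f dμ_w = (N+1)⁻¹ ∑ᵢ f(wᵢ)`. -/
theorem psvT_integral_empiricalMeasure_vec (w : Phase N) (f : T3 × V3 → V3) :
    ∫ q, f q ∂(empiricalMeasure w) = ((N + 1 : ℕ) : ℝ)⁻¹ • ∑ i, f (w i) := by
  rw [Literature.Analysis.FluidPDE.empiricalMeasure_eq, integral_smul_measure,
    integral_finsetSum_measure fun i _ => integrable_dirac (by simp)]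
  simp [integral_dirac, ENNReal.toReal_inv]
  congr 1

/-- `q^kin_r` as a particle sum. -/
theorem psvT_qkinC_eq_sum (r : ℝ) (w : Phase N) (x₀ : T3) :
    qkinC r w x₀ = ((N + 1 : ℕ) : ℝ)⁻¹ •
      ∑ i, (cone r (w i).1 x₀ * (‖(w i).2 - uC r w x₀‖ ^ 2 / 2)) • ((w i).2 - uC r w x₀) := by
  unfold qkinC; rw [psvT_integral_empiricalMeasure_vec]

/-- A coordinate of `q^kin_r` as a particle sum. -/
theorem psvT_qkinC_apply_eq_sum (r : ℝ) (w : Phase N) (x₀ : T3) (k : Fin 3) :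
    qkinC r w x₀ k = ((N + 1 : ℕ) : ℝ)⁻¹ *
      ∑ i, cone r (w i).1 x₀ * (‖(w i).2 - uC r w x₀‖ ^ 2 / 2) * ((w i).2 k - uC r w x₀ k) := by
  rw [psvT_qkinC_eq_sum]
  simp only [PiLp.smul_apply, WithLp.ofLp_sum, Finset.sum_apply, smul_eq_mul, WithLp.ofLp_smul,
    Pi.smul_apply, WithLp.ofLp_sub, Pi.sub_apply]

/-- The coarse velocity is jointly Borel in (configuration, field point). -/
theorem psvT_measurable_uC_uncurry (r : ℝ) : Measurable fun p : Phase N × T3 => uC r p.1 p.2 :=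
  (continuous_rhoC_uncurry (N := N) r).measurable.inv.smul (continuous_momC_uncurry (N := N) r).measurable

/-- `q^kin_r` is jointly Borel in (configuration, field point). -/
theorem psvT_measurable_qkinC_uncurry (r : ℝ) : Measurable fun p : Phase N × T3 => qkinC r p.1 p.2 := by
  have h : (fun p : Phase N × T3 => qkinC r p.1 p.2) = fun p => ((N + 1 : ℕ) : ℝ)⁻¹ •
      ∑ i, (cone r (p.1 i).1 p.2 * (‖(p.1 i).2 - uC r p.1 p.2‖ ^ 2 / 2)) • ((p.1 i).2 - uC r p.1 p.2) := by
    funext p; exact psvT_qkinC_eq_sum r p.1 p.2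
  rw [h]
  have hu := psvT_measurable_uC_uncurry (N := N) r
  have hterm : ∀ i : Fin (N + 1), Measurable fun p : Phase N × T3 =>
      (cone r (p.1 i).1 p.2 * (‖(p.1 i).2 - uC r p.1 p.2‖ ^ 2 / 2)) • ((p.1 i).2 - uC r p.1 p.2) := by
    intro i
    have hb : Measurable fun p : Phase N × T3 => cone r (p.1 i).1 p.2 :=
      (continuous_cone_comp r ((continuous_apply i).comp continuous_fst).fst continuous_snd).measurable
    have hv : Measurable fun p : Phase N × T3 => (p.1 i).2 - uC r p.1 p.2 :=
      ((continuous_apply i).comp continuous_fst).snd.measurable.sub hu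
    exact (hb.mul ((hv.norm.pow_const 2).div_const 2)).smul hv
  exact Measurable.const_smul (M := ℝ) (Finset.measurable_sum Finset.univ fun i _ => hterm i) _

/-- On the density floor the coarse speed is at most `U = (3/πr³)(½ + ke)/c`. -/
theorem psvT_norm_uC_le {r c : ℝ} (hr : 0 < r) (hc : 0 < c) {w : Phase N} {x₀ : T3} (hρ : c ≤ rhoC r w x₀) :
    ‖uC r w x₀‖ ≤ 3 / (Real.pi * r ^ 3) * (1 / 2 + ke w) / c := by
  have hρpos : 0 < rhoC r w x₀ := hc.trans_le hρ
  unfold uC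
  rw [norm_smul, Real.norm_eq_abs, abs_of_pos (inv_pos.2 hρpos), le_div_iff₀ hc]
  calc (rhoC r w x₀)⁻¹ * ‖momC r w x₀‖ * c ≤ (rhoC r w x₀)⁻¹ * ‖momC r w x₀‖ * rhoC r w x₀ := by
        gcongr
    _ = ‖momC r w x₀‖ := by field_simp
    _ ≤ _ := norm_momC_le hr w x₀

/-- One particle's speed is controlled by the total kinetic energy: `‖vᵢ‖ ≤ ½ + (N+1) ke`. -/
theorem psvT_norm_vel_le (w : Phase N) (i : Fin (N + 1)) : ‖(w i).2‖ ≤ 1 / 2 + ((N + 1 : ℕ) : ℝ) * ke w := by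
  have h1 : ‖(w i).2‖ ^ 2 / 2 ≤ ((N + 1 : ℕ) : ℝ) * ke w := by
    unfold ke
    rw [← mul_assoc, mul_inv_cancel₀ (by positivity), one_mul]
    exact Finset.single_le_sum (f := fun j => ‖(w j).2‖ ^ 2 / 2) (fun j _ => by positivity) (Finset.mem_univ i)
  nlinarith [sq_nonneg (‖(w i).2‖ - 1), norm_nonneg (w i).2]

/-- **Bound of the cubic heat current on the density floor**: `‖q^kin_r(x₀)‖ ≤ (3/πr³) V³/2` with
`V = ½ + (N+1)ke + (3/πr³)(½+ke)/c` a bound of every peculiar speed `‖vᵢ − u_r(x₀)‖` (crude, `N`-dependent: along ONE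
orbit the cubic moment is bounded, which is all the honesty of `T₃kin` needs). -/
theorem psvT_norm_qkinC_le {r c : ℝ} (hr : 0 < r) (hc : 0 < c) {w : Phase N} {x₀ : T3} (hρ : c ≤ rhoC r w x₀) :
    ‖qkinC r w x₀‖ ≤ 3 / (Real.pi * r ^ 3) *
      (1 / 2 + ((N + 1 : ℕ) : ℝ) * ke w + 3 / (Real.pi * r ^ 3) * (1 / 2 + ke w) / c) ^ 3 / 2 := by
  set V : ℝ := 1 / 2 + ((N + 1 : ℕ) : ℝ) * ke w + 3 / (Real.pi * r ^ 3) * (1 / 2 + ke w) / c with hV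
  have hke := ke_nonneg w
  have hU := psvT_norm_uC_le hr hc hρ
  have hVi : ∀ i, ‖(w i).2 - uC r w x₀‖ ≤ V := fun i =>
    (norm_sub_le _ _).trans (add_le_add (psvT_norm_vel_le w i) hU)
  have hV0 : 0 ≤ V := (norm_nonneg _).trans (hVi 0)
  rw [psvT_qkinC_eq_sum, norm_smul, Real.norm_eq_abs, abs_of_nonneg (by positivity)]
  calc ((N + 1 : ℕ) : ℝ)⁻¹ * ‖∑ i, (cone r (w i).1 x₀ * (‖(w i).2 - uC r w x₀‖ ^ 2 / 2)) • ((w i).2 - uC r w x₀)‖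
      ≤ ((N + 1 : ℕ) : ℝ)⁻¹ * ∑ _i : Fin (N + 1), 3 / (Real.pi * r ^ 3) * V ^ 3 / 2 := by
        gcongr
        refine (norm_sum_le _ _).trans (Finset.sum_le_sum fun i _ => ?_)
        rw [norm_smul, Real.norm_eq_abs, abs_of_nonneg (mul_nonneg (cone_nonneg hr _ _) (by positivity))]
        have hb := cone_le_const hr (w i).1 x₀
        have hb0 := cone_nonneg hr (w i).1 x₀
        have hv := hVi i
        have hv0 := norm_nonneg ((w i).2 - uC r w x₀)
        calc cone r (w i).1 x₀ * (‖(w i).2 - uC r w x₀‖ ^ 2 / 2) * ‖(w i).2 - uC r w x₀‖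
            = cone r (w i).1 x₀ * (‖(w i).2 - uC r w x₀‖ ^ 3 / 2) := by ring
          _ ≤ 3 / (Real.pi * r ^ 3) * (V ^ 3 / 2) := by
              refine mul_le_mul hb ?_ (by positivity) (by positivity)
              gcongr
          _ = _ := by ring
    _ = 3 / (Real.pi * r ^ 3) * V ^ 3 / 2 := by
        rw [Finset.sum_const, Finset.card_univ, Fintype.card_fin, nsmul_eq_mul, ← mul_assoc,
          inv_mul_cancel₀ (by positivity), one_mul]

/-! ## The coarse temperature on the floors: continuity, Lipschitz bound, bounded `pD` -/

/-- `e_r` is `(3/πr⁴) ke`-Lipschitz in the field point (minimal-image distance). -/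
theorem psvT_abs_kinC_sub_le {r : ℝ} (hr : 0 < r) (w : Phase N) (x x' : T3) :
    |kinC r w x - kinC r w x'| ≤ 3 / (Real.pi * r ^ 4) * ke w * Torus.euclidDist x x' := by
  rw [kinC_eq_sum, kinC_eq_sum, ← mul_sub, ← Finset.sum_sub_distrib, abs_mul,
    abs_of_nonneg (by positivity : (0:ℝ) ≤ ((N + 1 : ℕ) : ℝ)⁻¹)]
  have hd : 0 ≤ Torus.euclidDist x x' := by rw [Torus.euclidDist_eq]; exact norm_nonneg _
  unfold ke
  calc ((N + 1 : ℕ) : ℝ)⁻¹ * |∑ i, (cone r (w i).1 x * (‖(w i).2‖ ^ 2 / 2) - cone r (w i).1 x' * (‖(w i).2‖ ^ 2 / 2))|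
      ≤ ((N + 1 : ℕ) : ℝ)⁻¹ * ∑ i, 3 / (Real.pi * r ^ 4) * Torus.euclidDist x x' * (‖(w i).2‖ ^ 2 / 2) := by
        gcongr
        refine (Finset.abs_sum_le_sum_abs _ _).trans (Finset.sum_le_sum fun i _ => ?_)
        rw [← sub_mul, abs_mul, abs_of_nonneg (by positivity : (0:ℝ) ≤ ‖(w i).2‖ ^ 2 / 2)]
        refine mul_le_mul_of_nonneg_right ?_ (by positivity)
        have h := gridUp_abs_cone_sub_cone_le hr x x' (w i).1
        rw [← densMod_cone_comm r x (w i).1, ← densMod_cone_comm r x' (w i).1] at h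
        exact h
    _ = 3 / (Real.pi * r ^ 4) * (((N + 1 : ℕ) : ℝ)⁻¹ * ∑ i, ‖(w i).2‖ ^ 2 / 2) * Torus.euclidDist x x' := by
        rw [← Finset.mul_sum]; ring

/-- On `{ρ_r ≠ 0}` the coarse temperature reads `θ_r = (2/3)(e_r/ρ_r − ‖u_r‖²/2)`. -/
theorem psvT_thetaC_eq_uC {r : ℝ} {w : Phase N} {x₀ : T3} (hρ : rhoC r w x₀ ≠ 0) :
    thetaC r w x₀ = 2 / 3 * (kinC r w x₀ / rhoC r w x₀ - ‖uC r w x₀‖ ^ 2 / 2) := by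
  unfold thetaC uC
  rw [norm_smul, Real.norm_eq_abs, mul_pow, sq_abs, inv_pow]
  congr 2
  field_simp

/-- Under a density floor EVERYWHERE the coarse temperature is continuous in the field point. -/
theorem psvT_continuous_thetaC {r c : ℝ} (hc : 0 < c) {w : Phase N} (hρ : ∀ y, c ≤ rhoC r w y) :
    Continuous fun y => thetaC r w y := by
  have hne : ∀ y, rhoC r w y ≠ 0 := fun y => (hc.trans_le (hρ y)).ne'
  have hρc : Continuous fun y => rhoC r w y := continuous_rhoC r w
  have hk : Continuous fun y => kinC r w y := continuous_kinC r w
  have hm : Continuous fun y => momC r w y := continuous_momC r w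
  unfold thetaC
  exact continuous_const.mul ((hk.div hρc hne).sub ((hm.norm.pow 2).div (continuous_const.mul (hρc.pow 2))
    fun y => mul_ne_zero two_ne_zero (pow_ne_zero 2 (hne y))))

/-- **Lipschitz bound of the coarse temperature on the density floor** (`c ≤ ρ_r` everywhere, `0 < r`, `0 < c`):
`|θ_r(x) − θ_r(x')| ≤ L_θ(r, c, ke) d(x, x')` with the explicit constant
`L_θ = (2/3)[(3/πr⁴)ke/c + (3/πr³)ke(3/πr⁴)/c² + K_u · U]`, `K_u` the strain constant of `norm_uC_sub_le` and
`U = (3/πr³)(½+ke)/c` the speed bound (`θ_r = (2/3)(e_r/ρ_r − ‖u_r‖²/2)`, quotient and square estimates). -/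
theorem psvT_abs_thetaC_sub_le {r c : ℝ} (hr : 0 < r) (hc : 0 < c) {w : Phase N} (hρ : ∀ y, c ≤ rhoC r w y)
    (x x' : T3) :
    |thetaC r w x - thetaC r w x'| ≤
      2 / 3 * (3 / (Real.pi * r ^ 4) * ke w / c + 3 / (Real.pi * r ^ 3) * ke w * (3 / (Real.pi * r ^ 4)) / c ^ 2 +
        (3 / (Real.pi * r ^ 4) * (1 / 2 + ke w) / c + 3 / (Real.pi * r ^ 3) * (1 / 2 + ke w) * (3 / (Real.pi * r ^ 4)) / c ^ 2) *
          (3 / (Real.pi * r ^ 3) * (1 / 2 + ke w) / c)) * Torus.euclidDist x x' := by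
  set d := Torus.euclidDist x x' with hd
  have hd0 : 0 ≤ d := by rw [hd, Torus.euclidDist_eq]; exact norm_nonneg _
  have hke := ke_nonneg w
  set R := rhoC r w x with hR
  set R' := rhoC r w x' with hR'
  set K := kinC r w x with hK
  set K' := kinC r w x' with hK'
  have hRc : c ≤ R := hρ x
  have hR'c : c ≤ R' := hρ x'
  have hRpos : 0 < R := hc.trans_le hRc
  have hR'pos : 0 < R' := hc.trans_le hR'c
  have hK'0 : 0 ≤ K' := kinC_nonneg hr w x'
  have hK'le : K' ≤ 3 / (Real.pi * r ^ 3) * ke w := psvK_kinC_le hr w x'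
  have hKK : |K - K'| ≤ 3 / (Real.pi * r ^ 4) * ke w * d := psvT_abs_kinC_sub_le hr w x x'
  have hRR : |R - R'| ≤ 3 / (Real.pi * r ^ 4) * d := abs_rhoC_sub_le hr w x x'
  have hU := psvT_norm_uC_le hr hc (hρ x)
  have hU' := psvT_norm_uC_le hr hc (hρ x')
  have huu := norm_uC_sub_le hr hc w hρ x x'
  rw [psvT_thetaC_eq_uC hRpos.ne', psvT_thetaC_eq_uC hR'pos.ne', ← hR, ← hR', ← hK, ← hK', ← mul_sub, abs_mul,
    abs_of_pos (by norm_num : (0:ℝ) < 2 / 3), mul_assoc]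
  refine mul_le_mul_of_nonneg_left ?_ (by norm_num)
  have hsplit : K / R - ‖uC r w x‖ ^ 2 / 2 - (K' / R' - ‖uC r w x'‖ ^ 2 / 2) =
      ((K - K') / R + K' * (R' - R) / (R * R')) - (‖uC r w x‖ - ‖uC r w x'‖) * ((‖uC r w x‖ + ‖uC r w x'‖) / 2) := by
    field_simp; ring
  rw [hsplit]
  refine (abs_sub _ _).trans ?_
  have h1 : |(K - K') / R + K' * (R' - R) / (R * R')| ≤
      3 / (Real.pi * r ^ 4) * ke w / c * d + 3 / (Real.pi * r ^ 3) * ke w * (3 / (Real.pi * r ^ 4)) / c ^ 2 * d := by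
    refine (abs_add_le _ _).trans (add_le_add ?_ ?_)
    · rw [abs_div, abs_of_pos hRpos, div_le_iff₀ hRpos]
      calc |K - K'| ≤ 3 / (Real.pi * r ^ 4) * ke w * d := hKK
        _ = 3 / (Real.pi * r ^ 4) * ke w / c * d * c := by field_simp
        _ ≤ 3 / (Real.pi * r ^ 4) * ke w / c * d * R := by gcongr
    · rw [abs_div, abs_mul, abs_of_nonneg hK'0, abs_of_pos (mul_pos hRpos hR'pos), abs_sub_comm,
        div_le_iff₀ (mul_pos hRpos hR'pos)]
      calc K' * |R - R'| ≤ 3 / (Real.pi * r ^ 3) * ke w * (3 / (Real.pi * r ^ 4) * d) :=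
            mul_le_mul hK'le hRR (abs_nonneg _) (by positivity)
        _ = 3 / (Real.pi * r ^ 3) * ke w * (3 / (Real.pi * r ^ 4)) / c ^ 2 * d * (c * c) := by field_simp
        _ ≤ 3 / (Real.pi * r ^ 3) * ke w * (3 / (Real.pi * r ^ 4)) / c ^ 2 * d * (R * R') := by gcongr
  have h2 : |(‖uC r w x‖ - ‖uC r w x'‖) * ((‖uC r w x‖ + ‖uC r w x'‖) / 2)| ≤
      (3 / (Real.pi * r ^ 4) * (1 / 2 + ke w) / c + 3 / (Real.pi * r ^ 3) * (1 / 2 + ke w) * (3 / (Real.pi * r ^ 4)) / c ^ 2) * d *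
        (3 / (Real.pi * r ^ 3) * (1 / 2 + ke w) / c) := by
    rw [abs_mul, abs_of_nonneg (by positivity : (0:ℝ) ≤ (‖uC r w x‖ + ‖uC r w x'‖) / 2)]
    refine mul_le_mul ((abs_norm_sub_norm_le _ _).trans huu) (by linarith) (by positivity) (by positivity)
  linarith [h1, h2]

/-- **The resolved temperature gradient is bounded on the density floor** (junk branch included):
`|∂ₖθ_r(x)| ≤ L_θ(r, c, ke)` (`abs_pD_le_of_lipschitz`). -/
theorem psvT_abs_pD_thetaC_le {r c : ℝ} (hr : 0 < r) (hc : 0 < c) {w : Phase N} (hρ : ∀ y, c ≤ rhoC r w y)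
    (k : Fin 3) (x : T3) :
    |pD k (fun y => thetaC r w y) x| ≤
      2 / 3 * (3 / (Real.pi * r ^ 4) * ke w / c + 3 / (Real.pi * r ^ 3) * ke w * (3 / (Real.pi * r ^ 4)) / c ^ 2 +
        (3 / (Real.pi * r ^ 4) * (1 / 2 + ke w) / c + 3 / (Real.pi * r ^ 3) * (1 / 2 + ke w) * (3 / (Real.pi * r ^ 4)) / c ^ 2) *
          (3 / (Real.pi * r ^ 3) * (1 / 2 + ke w) / c)) := by
  have hke := ke_nonneg w
  exact abs_pD_le_of_lipschitz (by positivity) (fun y y' => psvT_abs_thetaC_sub_le hr hc hρ y y') k x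

/-- The FLOORED coarse temperature `max((2/3)(e_r/max(ρ_r,c) − ‖m_r‖²/(2max(ρ_r,c)²)), c)` is jointly continuous in
(configuration, field point) for `0 < c` — the honest object behind `θ_r` in the measurability of `T₃kin`'s integrand. -/
theorem psvT_continuous_thetaFl_uncurry {c : ℝ} (hc : 0 < c) (r : ℝ) :
    Continuous fun p : Phase N × T3 => max (2 / 3 * (kinC r p.1 p.2 / max (rhoC r p.1 p.2) c -
      ‖momC r p.1 p.2‖ ^ 2 / (2 * max (rhoC r p.1 p.2) c ^ 2))) c := by
  have hρ := (continuous_rhoC_uncurry (N := N) r).max (continuous_const (y := c))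
  have hne : ∀ p : Phase N × T3, max (rhoC r p.1 p.2) c ≠ 0 := fun p => (hc.trans_le (le_max_right _ _)).ne'
  have hk := continuous_kinC_uncurry (N := N) r
  have hm := continuous_momC_uncurry (N := N) r
  exact (continuous_const.mul ((hk.div hρ hne).sub ((hm.norm.pow 2).div (continuous_const.mul (hρ.pow 2))
    fun p => mul_ne_zero two_ne_zero (pow_ne_zero 2 (hne p))))).max continuous_const

/-- On the floors `c ≤ ρ_r`, `c ≤ θ_r` (everywhere) the floored temperature IS the coarse temperature, as functions
of the field point (which is all `pD` sees). -/
theorem psvT_thetaFl_eq_thetaC {c r : ℝ} {w : Phase N} (hρ : ∀ y, c ≤ rhoC r w y) (hθ : ∀ y, c ≤ thetaC r w y) :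
    (fun y => max (2 / 3 * (kinC r w y / max (rhoC r w y) c - ‖momC r w y‖ ^ 2 / (2 * max (rhoC r w y) c ^ 2))) c) =
      fun y => thetaC r w y := by
  funext y
  rw [max_eq_left (hρ y)]
  exact max_eq_left (hθ y)

/-! ## Registered sub-goals (stmt-AtomisticToContinuum-13081; signatures verbatim) -/

/-- Registered sub-goal `abs_pD_div_le`: quotient rule or junk for the crux's `pD`. -/
theorem abs_pD_div_le :
  ∀ {f g : T3 → ℝ} {k : Fin 3} {x : T3}, DifferentiableAt ℝ (fun t : ℝ => f (x + tproj (t • EuclideanSpace.single k (1 : ℝ)))) 0 → Continuous g → 0 < g x → |pD k (fun y => f y / g y) x| ≤ |pD k f x| / g x + |f x| * |pD k g x| / g x ^ 2 :=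
  fun hf hg hgx => psvT_abs_pD_div_le hf hg hgx

/-- Registered sub-goal `abs_pD_thetaC_le_of_floor`: the resolved temperature gradient is bounded by the explicit
Lipschitz constant `L_θ(r, c, ke)` on the density floor (junk branch included). -/
theorem abs_pD_thetaC_le_of_floor :
  ∀ {N : ℕ} {r c : ℝ}, 0 < r → 0 < c → ∀ {w : Phase N}, (∀ y, c ≤ rhoC r w y) → ∀ (k : Fin 3) (x : T3), |pD k (fun y => thetaC r w y) x| ≤ 2 / 3 * (3 / (Real.pi * r ^ 4) * ke w / c + 3 / (Real.pi * r ^ 3) * ke w * (3 / (Real.pi * r ^ 4)) / c ^ 2 + (3 / (Real.pi * r ^ 4) * (1 / 2 + ke w) / c + 3 / (Real.pi * r ^ 3) * (1 / 2 + ke w) * (3 / (Real.pi * r ^ 4)) / c ^ 2) * (3 / (Real.pi * r ^ 3) * (1 / 2 + ke w) / c)) :=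
  fun hr hc _ hρ k x => psvT_abs_pD_thetaC_le hr hc hρ k x

end Summit.AtomisticToContinuum.HydrodynamicLimit.Theorems.LocalSecondLawLedger

end
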